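import Summits.QuantumFields.YangMills.Theorems.ParabolicTrajectoryContinuumLimitOnTrajectoryUclSlab
import Summits.QuantumFields.YangMills.Theorems.ParabolicTrajectoryContinuumLimitOnTrajectoryStubArpB
import Summits.QuantumFields.YangMills.Theorems.ParabolicTrajectoryContinuumLimitOnTrajectoryStubArpC

/-!
# Crux `ContinuumLimitOnTrajectory` (stmt-QuantumFields-10522), line `two-orbit-synchronisation` (seat c2):
# the reflected self-pairing as a lattice-functional pairing (helper of `varBound_of_uuvb`, part A)

Helper file (`--supports stmt-QuantumFields-10522`) of wave-2 worker W2-VAR for the registered stub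
`stub_uclOfGap : UCLOfGap`; first step of the proof of `VarBound r sch` (…UclDefs) from `UUVB r sch`. In the currency of
worker A's lattice functionals `Arp.lat` (…StubArpA/B) — everything new in the sub-namespace `Var`; the plane reflection
`planeRefl sch k T U` of …UclDefs is written out as its definition `τ_{−T} (Θ' (τ_T U)) = timeShiftInt _ (−T) (timeShiftInt _ T U).negReflect`,
so that this file does not wait for …UclDefs:
* `Var.obsOf_eq_lat` — the lattice observable `obsOf` of …UclObs IS the lattice functional of the constant string of
  centred corner densities;
* `Var.torusLift_timeShiftInt` — the periodic lift of the integer time shift `τ_c` of the torus is the lattice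
  translation `configShift (−c e₀)` of the periodic lift;
* `Var.lat_timeShiftInt` — EXACT TIME TRANSLATION: reading `lat W F` on `τ_c U` is `lat W (T_{a_k c e₀} F)(U)` as soon as
  the time window of `F` translated by `a_k c` stays inside the box (no seam terms);
* `Var.pairing_planeRefl_eq` — THE REFLECTION IDENTITY: for a test function windowed in `|t| ≤ Tb` with
  `Tb + a_k |T| ≤ a_k L_k`, `∫ obsOf Φ · conj (obsOf Φ ∘ τ_{−T} ∘ Θ' ∘ τ_T) dμ_k = ∫ lat P̃ Φ_T · lat (P̃∘Θ₀) (conj θΦ_T) dμ_k`,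
  `Φ_T = T_{−a_k T e₀} Φ = translateMulti (a_k • siteToE (−T e₀)) Φ` (time-shift invariance of Wilson's measure moves the plane
  to `0`; then worker A's exact reflection `lat_negReflect`). No new definitions.
-/

set_option autoImplicit false

open scoped SchwartzMap ComplexConjugate
open MeasureTheory Filter Topology
open Literature.MathematicalPhysics.QuantumFieldTheory Literature.MathematicalPhysics.QuantumLattice
open Literature.MathematicalPhysics.AQFT Literature.Probability.LatticeModels

noncomputable section

namespace Summit.QuantumFields.YangMills.Cruxes.ContinuumLimitOnTrajectory.TwoOrbitSynchronisation

namespace Var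

/-! ## The observable as a lattice functional; lifts of time shifts -/

section Lift

variable {G : Type} [MeasurableSpace G]

/-- **The periodic lift of an integer time shift is a lattice translation of the periodic lift**:
`(τ_c U)~ = configShift (−c e₀) Ũ`. -/
theorem torusLift_timeShiftInt (Sd : ℕ) (c : ℤ) (U : GaugeConfig 4 Sd G) :
    torusLift Sd (timeShiftInt Sd c U) =
      Literature.MathematicalPhysics.QuantumLattice.configShift (-(Pi.single 0 c : Site 4)) (torusLift Sd U) := by
  funext e
  have h : Torus.proj Sd (e.1 + (Pi.single 0 c : Site 4)) = Torus.proj Sd e.1 + Torus.proj Sd (Pi.single 0 c) := by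
    funext i; simp [Torus.proj_apply]
  simp only [torusLift, Function.comp_apply, torusEdge, timeShiftInt_apply,
    Literature.MathematicalPhysics.QuantumLattice.configShift_apply, sub_neg_eq_add, h]

end Lift

section Lat

variable {G : Type} [Group G] [TopologicalSpace G] [IsTopologicalGroup G] [CompactSpace G]
  [MeasurableSpace G] [BorelSpace G]

/-- **The lattice observable of …UclObs is the lattice functional of the constant string of centred corner
densities** (the literal unit weight of `cw` is `1`, `Arp.cw_eq_cen`). -/
theorem obsOf_eq_lat (r : LatticeRep G) (sch : SpeciesScheme (YMSpecies G)) (k p : ℕ) (F : 𝓢((Fin p → EuclideanSpace ℝ (Fin 4)), ℂ))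
    (U : GaugeConfig 4 (sch.side k) G) :
    obsOf r sch k p F U = Arp.lat sch k (fun _ => Arp.cen r sch k r.curvature.F) F U := by
  simp only [obsOf, Arp.cw_eq_cen, Arp.lat]

omit [TopologicalSpace G] [IsTopologicalGroup G] [CompactSpace G] [BorelSpace G] in
/-- **Exact time translation of the lattice functional.** If `F` vanishes at configurations with a time coordinate of
modulus `> Tb` and `Tb + a_k |c| ≤ a_k L_k`, then reading `lat W F` on the time-shifted torus configuration `τ_c U` is the
lattice functional of `W` against the translated test function `T_{a_k c e₀} F` (the translated box strings stay in the
box: no seam terms). -/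
theorem lat_timeShiftInt (sch : SpeciesScheme (YMSpecies G)) (k : ℕ) {p : ℕ} (W : Fin p → LGConfig 4 G → ℝ)
    (F : 𝓢((Fin p → EuclideanSpace ℝ (Fin 4)), ℂ)) {Tb : ℝ} (hF : ∀ x, F x ≠ 0 → ∀ i, |x i 0| ≤ Tb) (c : ℤ)
    (hT : Tb + sch.a k * |(c : ℝ)| ≤ sch.a k * sch.L k) (U : GaugeConfig 4 (sch.side k) G) :
    Arp.lat sch k W F (timeShiftInt (sch.side k) c U) =
      Arp.lat sch k W (translateMulti (sch.a k • siteToE (Pi.single 0 c : Site 4)) F) U := by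
  set a := sch.a k with ha_def
  have ha : 0 < a := sch.a_pos k
  set L := sch.L k with hL_def
  set Ut := torusLift (sch.side k) U with hUt
  set v : Site 4 := Pi.single 0 c with hv
  let vv : Fin p → Site 4 := fun _ => v
  have siteToE_sub : ∀ x y : Site 4, siteToE (x - y) = siteToE x - siteToE y := fun x y => by
    ext j; simp [siteToE_apply]
  rw [Arp.lat, Arp.lat, torusLift_timeShiftInt, ← hUt]
  -- both sides as sums over site strings
  let f : (Fin p → Site 4) → ℂ := fun x => F (fun i => a • siteToE (x i)) *
    ∏ i, ((W i (Literature.MathematicalPhysics.QuantumLattice.configShift (-(x i)) (Literature.MathematicalPhysics.QuantumLattice.configShift (-v) Ut)) : ℝ) : ℂ)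
  let g : (Fin p → Site 4) → ℂ := fun y => (translateMulti (a • siteToE v) F) (fun i => a • siteToE (y i)) *
    ∏ i, ((W i (Literature.MathematicalPhysics.QuantumLattice.configShift (-(y i)) Ut) : ℝ) : ℂ)
  have hfg : ∀ x, f x = g (x + vv) := by
    intro x
    simp only [f, g, vv, translateMulti_apply, Pi.add_apply]
    congr 1
    · congr 1
      funext i
      rw [← smul_sub, ← siteToE_sub, add_sub_cancel_right]
    · refine Finset.prod_congr rfl fun i _ => ?_
      rw [Arp.configShift_configShift, neg_add]
  -- time bounds on the support
  have hbnd : ∀ x : Fin p → Site 4, F (fun i => a • siteToE (x i)) ≠ 0 → ∀ i, |x i 0| + |c| ≤ (L : ℤ) := by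
    intro x hx i
    have h := hF _ hx i
    simp only [PiLp.smul_apply, siteToE_apply, smul_eq_mul] at h
    rw [abs_mul, abs_of_pos ha] at h
    have h2 : a * (|(x i 0 : ℝ)| + |(c : ℝ)|) ≤ a * L := by nlinarith [abs_nonneg (c : ℝ)]
    have h3 : |(x i 0 : ℝ)| + |(c : ℝ)| ≤ L := le_of_mul_le_mul_left h2 ha
    have h4 : ((|x i 0| + |c| : ℤ) : ℝ) ≤ (L : ℤ) := by push_cast; exact h3
    exact_mod_cast h4
  have hvj : ∀ j : Fin 4, j ≠ 0 → v j = 0 := fun j hj => by simp [hv, hj]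
  have hv0 : v 0 = c := by simp [hv]
  have hmem : ∀ y : Fin p → Site 4, (∀ i j, j ≠ 0 → -(L : ℤ) ≤ y i j ∧ y i j ≤ L) →
      (∀ i, -(L : ℤ) ≤ y i 0 ∧ y i 0 ≤ L) → y ∈ Fintype.piFinset (fun _ : Fin p => box 4 L) := by
    intro y h1 h2
    rw [Fintype.mem_piFinset]
    intro i
    rw [mem_box]
    intro j
    by_cases hj : j = 0
    · subst hj; exact h2 i
    · exact h1 i j hj
  rw [Arp.sum_boxFun_eq f, Arp.sum_boxFun_eq g]
  refine Finset.sum_bij_ne_zero (fun y _ _ => y + vv) (fun y hy hne => ?_)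
    (fun y₁ _ _ y₂ _ _ h => add_right_cancel h) (fun z hz hne => ?_) (fun y _ _ => hfg y)
  · have hb := hbnd y (left_ne_zero_of_mul hne)
    rw [Fintype.mem_piFinset] at hy
    refine hmem _ (fun i j hj => ?_) (fun i => ?_)
    · rw [Pi.add_apply, Pi.add_apply, show vv i j = 0 from hvj j hj, add_zero]; exact mem_box.1 (hy i) j
    · have hbi := hb i
      have h5 := le_abs_self (y i 0)
      have h6 := neg_abs_le (y i 0)
      have h7 := le_abs_self c
      have h8 := neg_abs_le c
      rw [Pi.add_apply, Pi.add_apply, show vv i 0 = c from hv0]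
      constructor <;> omega
  · have hz' : F (fun i => a • siteToE ((z - vv) i)) ≠ 0 := by
      have h := left_ne_zero_of_mul hne
      simp only [translateMulti_apply] at h
      have h1 : (fun i => a • siteToE (z i) - a • siteToE v) = fun i => a • siteToE ((z - vv) i) := by
        funext i; rw [Pi.sub_apply, siteToE_sub, smul_sub]
      rwa [h1] at h
    refine ⟨z - vv, ?_, ?_, sub_add_cancel z _⟩
    · have hb := hbnd _ hz'
      rw [Fintype.mem_piFinset] at hz
      refine hmem _ (fun i j hj => ?_) (fun i => ?_)
      · rw [Pi.sub_apply, Pi.sub_apply, show vv i j = 0 from hvj j hj, sub_zero]; exact mem_box.1 (hz i) j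
      · have hbi := hb i
        rw [Pi.sub_apply, Pi.sub_apply, show vv i 0 = c from hv0] at hbi ⊢
        have h5 := le_abs_self (z i 0 - c)
        have h6 := neg_abs_le (z i 0 - c)
        have h7 := le_abs_self c
        have h8 := neg_abs_le c
        constructor <;> omega
    · rw [hfg, sub_add_cancel]; exact hne

/-! ## The reflection identity -/

omit [TopologicalSpace G] [IsTopologicalGroup G] [CompactSpace G] [BorelSpace G] in
/-- The plane reflection `τ_{−T} ∘ Θ' ∘ τ_T` after the time shift `τ_{−T}` is `τ_{−T} ∘ Θ'`. -/
theorem planeRefl_timeShiftInt (sch : SpeciesScheme (YMSpecies G)) (k : ℕ) (T : ℤ) (U : GaugeConfig 4 (sch.side k) G) :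
    timeShiftInt (sch.side k) (-T) (timeShiftInt (sch.side k) T (timeShiftInt (sch.side k) (-T) U)).negReflect =
      timeShiftInt (sch.side k) (-T) U.negReflect := by
  simp only [timeShiftInt_timeShiftInt, add_neg_cancel, timeShiftInt_zero]

/-- **THE REFLECTION IDENTITY.** For a test function vanishing at configurations with a time coordinate of modulus
`> Tb`, `Tb + a_k |T| ≤ a_k L_k`, the reflected self-pairing of its lattice observable across the time plane `T`
(`planeRefl sch k T U = τ_{−T} (Θ' (τ_T U))` of …UclDefs, written out) is the
torus expectation of the product of two lattice functionals at the plane `0`: the centred corner densities against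
the SHIFTED test function `Φ_T = T_{−a_k T e₀} Φ` (`Φ_T(u) = Φ(u + a_k T e₀)` in every slot) and the REFLECTED centred corner
densities `P̃ ∘ Θ₀` against `conj θΦ_T` (`Arp.Ftil`). -/
theorem pairing_planeRefl_eq (r : LatticeRep G) (sch : SpeciesScheme (YMSpecies G)) (k p : ℕ)
    (Φ : 𝓢((Fin p → EuclideanSpace ℝ (Fin 4)), ℂ)) (T : ℤ) {Tb : ℝ} (hΦ : ∀ x, Φ x ≠ 0 → ∀ i, |x i 0| ≤ Tb)
    (hT : Tb + sch.a k * |(T : ℝ)| ≤ sch.a k * sch.L k) :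
    ∫ U, obsOf r sch k p Φ U * conj (obsOf r sch k p Φ
        (timeShiftInt (sch.side k) (-T) (timeShiftInt (sch.side k) T U).negReflect)) ∂(μW r sch k) =
      ∫ U, Arp.lat sch k (fun _ => Arp.cen r sch k r.curvature.F) (translateMulti (sch.a k • siteToE (Pi.single 0 (-T) : Site 4)) Φ) U *
        Arp.lat sch k (fun _ V => Arp.cen r sch k r.curvature.F (cfgReflect V))
          (Arp.Ftil (translateMulti (sch.a k • siteToE (Pi.single 0 (-T) : Site 4)) Φ)) U ∂(μW r sch k) := by
  rw [← integral_comp_timeShiftInt r.ρ (sch.β k) (sch.side k) (-T)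
    (fun U => obsOf r sch k p Φ U * conj (obsOf r sch k p Φ (timeShiftInt (sch.side k) (-T) (timeShiftInt (sch.side k) T U).negReflect)))]
  refine integral_congr_ae (Eventually.of_forall fun U => ?_)
  have hT' : Tb + sch.a k * |((-T : ℤ) : ℝ)| ≤ sch.a k * sch.L k := by simpa using hT
  simp only
  rw [planeRefl_timeShiftInt, obsOf_eq_lat, obsOf_eq_lat, lat_timeShiftInt sch k _ Φ hΦ (-T) hT' U,
    lat_timeShiftInt sch k _ Φ hΦ (-T) hT' U.negReflect, Arp.lat_negReflect, Arp.conj_lat]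

end Lat

end Var

/-- **Registered anchor of this file** (closed form of `Var.pairing_planeRefl_eq`, for the gate's `--supports` stub check):
the reflected self-pairing of the lattice observable of a windowed test function across the time plane `T` is the
pairing of the lattice functionals of the centred corner densities and of their reflections at the plane `0`. -/
theorem varA_pairing_planeRefl_eq :
    ∀ {G : Type} [Group G] [TopologicalSpace G] [IsTopologicalGroup G] [CompactSpace G] [MeasurableSpace G] [BorelSpace G]
      (r : LatticeRep G) (sch : SpeciesScheme (YMSpecies G)) (k p : ℕ)
      (Φ : 𝓢((Fin p → EuclideanSpace ℝ (Fin 4)), ℂ)) (T : ℤ) (Tb : ℝ),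
      (∀ x, Φ x ≠ 0 → ∀ i, |x i 0| ≤ Tb) → Tb + sch.a k * |(T : ℝ)| ≤ sch.a k * sch.L k →
      ∫ U, obsOf r sch k p Φ U *
        (starRingEnd ℂ) (obsOf r sch k p Φ (timeShiftInt (sch.side k) (-T) (timeShiftInt (sch.side k) T U).negReflect)) ∂(μW r sch k) =
        ∫ U, Arp.lat sch k (fun _ => Arp.cen r sch k r.curvature.F) (translateMulti (sch.a k • siteToE (Pi.single 0 (-T) : Site 4)) Φ) U *
          Arp.lat sch k (fun _ V => Arp.cen r sch k r.curvature.F (cfgReflect V))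
            (Arp.Ftil (translateMulti (sch.a k • siteToE (Pi.single 0 (-T) : Site 4)) Φ)) U ∂(μW r sch k) := by
  intro G _ _ _ _ _ _ r sch k p Φ T Tb hΦ hT
  exact Var.pairing_planeRefl_eq r sch k p Φ T hΦ hT

end Summit.QuantumFields.YangMills.Cruxes.ContinuumLimitOnTrajectory.TwoOrbitSynchronisation

end
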